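import Summits.ResolutionOfSingularities.ResolutionOfSingularities.Theorems.PurelyInseparableDim4ScopeBlindRationalNorm
import Mathlib.Algebra.MvPolynomial.NoZeroDivisors
import Mathlib.Algebra.MvPolynomial.Nilpotent
import HarnessLib

/-!
# A `decide`-able IRREDUCIBILITY check for two-variable term lists over a finite field
# (cell `res-dim4-pi`; tool for the algebraic-branch blindness certificate `…ScopeBlindAlgebraic`)

[OURS · counted 0 · instrument] Nothing here is a statement about resolution of singularities; resolution in
dimension `≥ 4` / characteristic `p > 0` is NOT proved by anything in this file.

On res-dim4-p-13's term lists (`StepKit.Terms 2 K`, `evalT`): the total degree `tdegL` with its transfer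
`totalDegree_evalT`; the degree box `monos2 d` and the exhaustive coefficient assignments `funLists` (complete for a
coefficient list `cs` containing every element of `K` — `ZMod 2`: `[0, 1]`); `boxList`/`evalT_boxList` (a polynomial
of total degree `≤ d` is presented on the box); and **`irredB cs D g`**: `g` non-constant of total degree `≤ D` and no
product `a · b = g` with `a` in the box of degree `D / 2`, `b` in the box of degree `D − 1`, both non-constant.
Soundness **`irreducible_of_irredB`** by `MvPolynomial.totalDegree_mul_of_isDomain` (a factorisation into two
non-units has both total degrees positive, the smaller `≤ D / 2`).  Cost: `|cs|^{#box(D/2)} · |cs|^{#box(D−1)}`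
products (`D = 3` over `𝔽₂`: 8 · 64).  OURS; counted 0; AI kernel work, weaker than expert review.
bears_on: LADDER-RESOLUTION:D157-DOOR2 (res-dim4-pi · F4-C instrument ‖ K · scope column).
Supports stmt-ResolutionOfSingularities-16155 (helper).
-/

set_option linter.dupNamespace false -- mandated namespace of this single-conjunct summit

noncomputable section

open MvPolynomial Finset
open scoped BigOperators

namespace Summit.ResolutionOfSingularities.ResolutionOfSingularities.Theorems.PIDim4

namespace ScopeBlind

open StepKit ScopeCover
open Literature.AlgebraicGeometry.Resolution

variable {K : Type} [Field K] [DecidableEq K]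

/-! ## The degree box, exhaustive coefficient lists, and the irreducibility check -/

/-- All exponents `(i, j)` with `i + j ≤ d`. [folklore] -/
def monos2 (d : ℕ) : List (Fin 2 → ℕ) :=
  (List.range (d + 1)).flatMap fun i => (List.range (d + 1 - i)).map fun j => ![i, j]

/-- Every exponent of total degree `≤ d` is listed. [folklore] -/
theorem mem_monos2 {d : ℕ} {e : Fin 2 → ℕ} (he : e 0 + e 1 ≤ d) : e ∈ monos2 d := by
  have hfun : e = ![e 0, e 1] := by funext i; fin_cases i <;> rfl
  rw [hfun]
  simp only [monos2, List.mem_flatMap, List.mem_range, List.mem_map]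
  exact ⟨e 0, by omega, e 1, by omega, rfl⟩

/-- All term lists `ms.map (m ↦ (m, f m))` with values `f m` drawn from `cs`. [folklore] -/
def funLists : List (Fin 2 → ℕ) → List K → List (Terms 2 K)
  | [], _ => [[]]
  | m :: ms, cs => cs.flatMap fun c => (funLists ms cs).map fun L => (m, c) :: L

omit [Field K] [DecidableEq K] in
/-- Completeness of `funLists`: the graph of any `cs`-valued function is listed. [folklore] -/
theorem map_mem_funLists (f : (Fin 2 → ℕ) → K) {cs : List K} (hf : ∀ m, f m ∈ cs) :
    ∀ ms : List (Fin 2 → ℕ), (ms.map fun m => (m, f m)) ∈ funLists ms cs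
  | [] => by simp [funLists]
  | m :: ms => by
    simp only [funLists, List.map_cons, List.mem_flatMap, List.mem_map, List.cons.injEq]
    exact ⟨f m, hf m, _, map_mem_funLists f hf ms, rfl, rfl⟩

/-- The total degree of a term list: the largest `|e|` over its LIVE exponents (`0` if none). [folklore] -/
def tdegL {n : ℕ} (L : Terms n K) : ℕ := (live L).foldr (fun e m => max (∑ i, e i) m) 0

omit [Field K] [DecidableEq K] in
/-- A listed exponent's degree is at most the fold. -/
theorem sum_le_foldr_of_mem {n : ℕ} {l : List (Fin n → ℕ)} {e : Fin n → ℕ} (h : e ∈ l) :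
    ∑ i, e i ≤ l.foldr (fun e m => max (∑ i, e i) m) 0 := by
  induction l with
  | nil => simp at h
  | cons b l ih =>
    simp only [List.foldr_cons]
    rcases List.mem_cons.mp h with rfl | h
    · exact le_max_left _ _
    · exact le_trans (ih h) (le_max_right _ _)

omit [Field K] [DecidableEq K] in
/-- The fold is attained at a listed exponent, or is `0`. -/
theorem foldr_eq_sum_or_zero {n : ℕ} (l : List (Fin n → ℕ)) :
    (∃ e ∈ l, l.foldr (fun e m => max (∑ i, e i) m) 0 = ∑ i, e i) ∨
      l.foldr (fun e m => max (∑ i, e i) m) 0 = 0 := by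
  induction l with
  | nil => exact Or.inr rfl
  | cons b l ih =>
    simp only [List.foldr_cons]
    rcases le_total (∑ i, b i) (l.foldr (fun e m => max (∑ i, e i) m) 0) with h | h
    · rw [max_eq_right h]
      rcases ih with ⟨e, he, heq⟩ | h0
      · exact Or.inl ⟨e, List.mem_cons_of_mem _ he, heq⟩
      · refine Or.inl ⟨b, List.mem_cons_self, ?_⟩
        rw [h0] at h ⊢
        exact (Nat.le_zero.mp h).symm
    · rw [max_eq_left h]
      exact Or.inl ⟨b, List.mem_cons_self, rfl⟩

/-- **Transfer of the total degree.** [folklore] -/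
theorem totalDegree_evalT {n : ℕ} (L : Terms n K) : (evalT L).totalDegree = tdegL L := by
  apply le_antisymm
  · rw [MvPolynomial.totalDegree]
    refine Finset.sup_le fun d hd => ?_
    have hlive : (⇑d) ∈ live L := (mem_support_evalT_iff L d).mp hd
    have hsum : (d.sum fun _ e => e) = ∑ i, d i := Finsupp.sum_fintype d _ (fun _ => rfl)
    rw [hsum]
    exact sum_le_foldr_of_mem hlive
  · rcases foldr_eq_sum_or_zero (live L) with ⟨e, he, heq⟩ | h
    · rw [tdegL, heq]
      have hsupp : expo e ∈ (evalT L).support := (expo_mem_support_iff L e).mpr he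
      have := MvPolynomial.le_totalDegree hsupp
      rw [Finsupp.sum_fintype _ _ (fun _ => rfl)] at this
      simpa only [expo_apply] using this
    · rw [tdegL, h]; exact Nat.zero_le _

/-- The canonical term list of a polynomial on the degree box `monos2 d`. [folklore] -/
def boxList (d : ℕ) (a : MvPolynomial (Fin 2) K) : Terms 2 K :=
  (monos2 d).map fun m => (m, coeff (expo m) a)

omit [DecidableEq K] in
/-- `coeffAt` of a graph list. -/
theorem coeffAt_map_graph (f : (Fin 2 → ℕ) → K) (e : Fin 2 → ℕ) :
    ∀ ms : List (Fin 2 → ℕ), coeffAt (ms.map fun m => (m, f m)) e = (ms.count e : ℕ) • f e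
  | [] => by simp [coeffAt]
  | m :: ms => by
    rw [List.map_cons, coeffAt, coeffAt_map_graph f e ms, List.count_cons]
    by_cases h : m = e
    · subst h
      rw [if_pos rfl, if_pos (beq_self_eq_true m), add_smul, one_smul, add_comm]
    · have h' : (m == e) = false := beq_false_of_ne h
      rw [if_neg h, h', zero_add]
      simp

omit [DecidableEq K] in
/-- `monos2 d` has no duplicates. -/
theorem nodup_monos2 (d : ℕ) : (monos2 d).Nodup := by
  unfold monos2
  rw [List.nodup_flatMap]
  constructor
  · intro i _
    refine List.Nodup.map (fun j j' h => ?_) List.nodup_range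
    have := congrArg (fun v : Fin 2 → ℕ => v 1) h
    simpa using this
  · refine List.nodup_range.pairwise_of_forall_ne fun i _ i' _ hne => ?_
    simp only [Function.onFun, List.disjoint_left, List.mem_map, List.mem_range, not_exists, not_and]
    rintro v ⟨j, _, rfl⟩ j' _ h
    have := congrArg (fun v : Fin 2 → ℕ => v 0) h
    simp only [Matrix.cons_val_zero] at this
    exact hne this.symm

/-- **Completeness of the box**: a polynomial of total degree `≤ d` is presented by its box list. [folklore] -/
theorem evalT_boxList {d : ℕ} {a : MvPolynomial (Fin 2) K} (ha : a.totalDegree ≤ d) :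
    evalT (boxList d a) = a := by
  ext e
  rw [coeff_evalT, boxList, coeffAt_map_graph (fun m => coeff (expo m) a) (⇑e) (monos2 d), expo_coe]
  by_cases he : (⇑e) ∈ monos2 d
  · rw [List.count_eq_one_of_mem (nodup_monos2 d) he, one_smul]
  · rw [List.count_eq_zero_of_not_mem he, zero_smul]
    symm
    by_contra hne
    apply he
    apply mem_monos2
    have h1 := MvPolynomial.le_totalDegree (mem_support_iff.mpr hne)
    have h2 : (e.sum fun _ k => k) = e 0 + e 1 := by
      rw [Finsupp.sum_fintype _ _ (fun _ => rfl), Fin.sum_univ_two]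
    rw [h2] at h1
    exact le_trans h1 ha

/-- The term list presents a CONSTANT (every live exponent is `0`). [folklore] -/
def isConstB {n : ℕ} (L : Terms n K) : Bool := (live L).all fun e => decide (e = fun _ => 0)

/-- A list passing `isConstB` presents `C c`. -/
theorem eq_C_of_isConstB {n : ℕ} {L : Terms n K} (h : isConstB L = true) :
    evalT L = C (coeff 0 (evalT L)) := by
  rw [← MvPolynomial.totalDegree_eq_zero_iff_eq_C, totalDegree_evalT, tdegL]
  simp only [isConstB, List.all_eq_true, decide_eq_true_eq] at h
  rcases foldr_eq_sum_or_zero (live L) with ⟨e, he, heq⟩ | h0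
  · rw [heq, h e he]
    simp
  · exact h0

/-- **Irreducibility check** for `g ∈ K[t, y]` given as a term list: `cs` must list every element of `K`
(hypothesis of the soundness theorem); `D` bounds the total degree of `g`; `g` is non-constant; and no product
`a · b` with `a` in the box of degree `D / 2`, `b` in the box of degree `D − 1`, both non-constant, equals `g`.
[folklore] -/
def irredB (cs : List K) (D : ℕ) (g : Terms 2 K) : Bool :=
  decide (tdegL g ≤ D) && !(isConstB g) &&
    (funLists (monos2 (D / 2)) cs).all fun a =>
      (funLists (monos2 (D - 1)) cs).all fun b =>
        isConstB a || isConstB b || !(StepKit.equivB (mulN a b) g)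

/-- **Soundness of the irreducibility check.** [folklore] -/
theorem irreducible_of_irredB {cs : List K} (hcs : ∀ c : K, c ∈ cs) {D : ℕ} {g : Terms 2 K}
    (h : irredB cs D g = true) : Irreducible (evalT g) := by
  simp only [irredB, Bool.and_eq_true, decide_eq_true_eq, Bool.not_eq_true', List.all_eq_true,
    Bool.or_eq_true] at h
  obtain ⟨⟨hD, hnc⟩, hall⟩ := h
  have hgdeg : (evalT g).totalDegree ≤ D := by rw [totalDegree_evalT]; exact hD
  have hg_not_const : (evalT g).totalDegree ≠ 0 := by
    intro h0
    rw [totalDegree_evalT] at h0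
    apply Bool.eq_false_iff.mp hnc
    simp only [isConstB, List.all_eq_true, decide_eq_true_eq]
    intro e he
    have hle : ∑ i, e i ≤ tdegL g := sum_le_foldr_of_mem he
    rw [h0, Nat.le_zero, Finset.sum_eq_zero_iff] at hle
    funext i; exact hle i (Finset.mem_univ i)
  have hg0 : evalT g ≠ 0 := fun h0 => hg_not_const (by rw [h0, totalDegree_zero])
  -- the key step: a factorisation with both factors of positive degree is listed and refuted
  have key : ∀ a b : MvPolynomial (Fin 2) K, evalT g = a * b → a.totalDegree ≤ b.totalDegree →
      a.totalDegree = 0 := by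
    intro a b hab hle
    by_contra hapos
    have ha0 : a ≠ 0 := by rintro rfl; exact hg0 (by rw [hab, zero_mul])
    have hb0 : b ≠ 0 := by rintro rfl; exact hg0 (by rw [hab, mul_zero])
    have hsum : (evalT g).totalDegree = a.totalDegree + b.totalDegree := by
      rw [hab, totalDegree_mul_of_isDomain ha0 hb0]
    have hadeg : a.totalDegree ≤ D / 2 := by omega
    have hbdeg : b.totalDegree ≤ D - 1 := by omega
    have hamem : boxList (D / 2) a ∈ funLists (monos2 (D / 2)) cs :=
      map_mem_funLists (fun m => coeff (expo m) a) (fun m => hcs _) _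
    have hbmem : boxList (D - 1) b ∈ funLists (monos2 (D - 1)) cs :=
      map_mem_funLists (fun m => coeff (expo m) b) (fun m => hcs _) _
    have hA : evalT (boxList (D / 2) a) = a := evalT_boxList hadeg
    have hB : evalT (boxList (D - 1) b) = b := evalT_boxList hbdeg
    rcases hall _ hamem _ hbmem with (hca | hcb) | hne
    · have := eq_C_of_isConstB hca
      rw [hA] at this
      exact hapos (by rw [this, totalDegree_C])
    · have := eq_C_of_isConstB hcb
      rw [hB] at this
      have hb' : b.totalDegree = 0 := by rw [this, totalDegree_C]
      exact hapos (by omega)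
    · apply Bool.eq_false_iff.mp hne
      rw [← evalT_eq_iff_equivB, evalT_mulN, hA, hB, hab]
  have unit_of : ∀ a : MvPolynomial (Fin 2) K, a ≠ 0 → a.totalDegree = 0 → IsUnit a := by
    intro a ha0 ha
    rw [MvPolynomial.isUnit_iff_totalDegree_of_isReduced]
    refine ⟨isUnit_iff_ne_zero.mpr fun h0 => ha0 ?_, ha⟩
    rw [(totalDegree_eq_zero_iff_eq_C).mp ha, h0, map_zero]
  refine irreducible_iff.mpr ⟨fun hu => ?_, fun a b hab => ?_⟩
  · exact hg_not_const ((MvPolynomial.isUnit_iff_totalDegree_of_isReduced).mp hu).2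
  · rcases le_total a.totalDegree b.totalDegree with hle | hle
    · have ha0 : a ≠ 0 := by rintro rfl; exact hg0 (by rw [hab, zero_mul])
      exact Or.inl (unit_of a ha0 (key a b hab hle))
    · have hb0 : b ≠ 0 := by rintro rfl; exact hg0 (by rw [hab, mul_zero])
      exact Or.inr (unit_of b hb0 (key b a (by rw [hab, mul_comm]) hle))

end ScopeBlind

end Summit.ResolutionOfSingularities.ResolutionOfSingularities.Theorems.PIDim4
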